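import Literature.Analysis.FluidPDE.TaoAveragedEuler
import Literature.Analysis.FluidPDE.HeatSubordinatedRiesz
import HarnessLib

/-!
# The Leray symbol on the Fourier transform of `(u·∇)v + (v·∇)u` for Schwartz divergence-free fields

Analysis/FluidPDE support file (everything **proved**; no definitions, no notation) for the
discharge of the named fact `Literature.Analysis.FluidPDE.exists_taoAverageData_op_eq_eulerBilinear`
(`TaoAveragedEuler.lean`; T. Tao, *Finite time blowup for an averaged three-dimensional
Navier–Stokes equation*, J. Amer. Math. Soc. 29 (2016), §1.1, (1.8)–(1.12)). The function-level
Euler bilinear operator of the tree is `B(u,v) = -½ Re 𝓕⁻[P̂(ξ) ŵ(ξ)]`, `w = (u·∇)v + (v·∇)u`,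
`P̂(ξ)c = c - (ξ·c/|ξ|²) ξ` (`leraySymbolC`). This file does the Schwartz-space bookkeeping
behind `B(u,v) ∈ L¹`: for Schwartz maps `U V ∈ 𝓢(ℝ^ι, ℝ^ι)` with `div U = div V = 0`,

* `w = (U·∇)V + (V·∇)U` is the Schwartz field `W₀ = ∑ⱼ (Uⱼ ∂ⱼV + Vⱼ ∂ⱼU)`
  (`coe_convectSchwartz`), and `w = div T` with the symmetric Schwartz tensor
  `T_{ji} = Uⱼ Vᵢ + Vⱼ Uᵢ` (`postcompCLM_proj_convectSchwartz`: the only place where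
  `div U = div V = 0` is used);
* hence, on the Fourier side, `ξ · ŵ(ξ) = (2πi)⁻¹ 𝓕ρ(ξ)` with `ρ = div w = ∑ᵢⱼ ∂ᵢ∂ⱼ T_{ji}`,
  and the singular part of the Leray symbol is a sum of third-order Riesz-type multipliers:
  `P̂(ξ) ŵ(ξ) = ŵ(ξ) + ∑ₖ M_k(ξ) e_k`, `M_k(ξ) = 𝓕(∂_k ρ)(ξ)/((2π)²|ξ|²)`
  (`leraySymbolC_fourier_eq`, valid for every Schwartz `W`), with
  `∂_k ρ = ∑ᵢⱼ ∂_k∂ᵢ∂ⱼ T_{ji}` (`lineDerivOp_divSchwartz_eq_sum`); packaged as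
  `exists_leraySymbolC_fourier_repr`, the input of
  `integrable_fourierInv_fourier_sum_lineDeriv₃_div_normSq` (`HeatSubordinatedRiesz.lean`).

Also: small Schwartz-space calculus on `ℝ^ι` (Leibniz rule for the bundled line derivative
`∂_{m}` of products, `∂_{m}` commutes with post-composition by a continuous linear map,
components, the divergence and the convective derivative in coordinates, coordinates through
the Fourier integral).

## Mathlib / tree search

Mathlib: `SchwartzMap.postcompCLM`, `SchwartzMap.pairing`, the `LineDeriv` notation class on
Schwartz space (`SchwartzMap.lineDerivOp_apply_eq_fderiv`, `LineDeriv.lineDerivOpCLM`),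
`FourierTransform.fourier_sum`, `EuclideanSpace.basisFun`, `EuclideanSpace.inner_single_right`,
`fderiv_fun_mul`, `fderiv_fun_smul`. Tree: `convect`, `VectorCalculus.divergence`,
`divergence_eq_sum_inner_fderiv` (`VectorCalculus`), `leraySymbolC`,
`FunctionSpaces.EuclideanSpace.complexify` (`TaoAveragedEuler`, `Complexify`),
`fourier_lineDeriv_apply` (`HeatSubordinatedRiesz`). (`LocalBiotSavartCalculus` has an `ℝ³`
version `fderiv_apply_coord` of `schwartz_fderiv_apply_coord`.)

## References

* T. Tao, J. Amer. Math. Soc. 29 (2016), 601–674 = arXiv:1402.0290v3, §1.1 ((1.8): `B`, `P`).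
  [`Tao2016`]
* P. G. Lemarié-Rieusset, *Recent developments in the Navier–Stokes problem* (2002), Ch. 11
  (the Leray projector as the multiplier `I − ξ ⊗ ξ/|ξ|²`). [`LemarieRieusset2002`]
-/

noncomputable section

open MeasureTheory Filter Topology Set Complex SchwartzMap
open scoped Real ENNReal NNReal FourierTransform RealInnerProductSpace LineDeriv
  ComplexConjugate

namespace Literature.Analysis.FluidPDE

variable {ι : Type*} [Fintype ι]

/-! ### Schwartz-space calculus on `ℝ^ι` -/

section SchwartzCalculus

variable {F : Type*} [NormedAddCommGroup F] [NormedSpace ℝ F]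
  {G : Type*} [NormedAddCommGroup G] [NormedSpace ℝ G]

/-- **`∂ₘ` commutes with post-composition by a continuous linear map**:
`∂ₘ (L ∘ f) = L ∘ ∂ₘ f` on Schwartz space (chain rule). [folklore] -/
theorem lineDerivOp_postcompCLM (L : F →L[ℝ] G) (f : 𝓢(EuclideanSpace ℝ ι, F))
    (m : EuclideanSpace ℝ ι) :
    (∂_{m} (postcompCLM L f) : 𝓢(EuclideanSpace ℝ ι, G)) =
      postcompCLM L (∂_{m} f : 𝓢(EuclideanSpace ℝ ι, F)) := by
  ext x
  rw [lineDerivOp_apply_eq_fderiv, postcompCLM_apply, lineDerivOp_apply_eq_fderiv]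
  have h : (⇑(postcompCLM L f) : EuclideanSpace ℝ ι → G) = ⇑L ∘ ⇑f :=
    funext fun y => postcompCLM_apply L f y
  rw [h, (L.hasFDerivAt.comp x (f.hasFDerivAt x)).fderiv]
  rfl

/-- **Leibniz rule for the bundled line derivative, scalar case**:
`∂ₘ (f g) = (∂ₘ f) g + f (∂ₘ g)` for `f g ∈ 𝓢(ℝ^ι, ℝ)`. [folklore] -/
theorem lineDerivOp_pairing_mul (f g : 𝓢(EuclideanSpace ℝ ι, ℝ)) (m : EuclideanSpace ℝ ι) :
    (∂_{m} (pairing (ContinuousLinearMap.mul ℝ ℝ) f g) : 𝓢(EuclideanSpace ℝ ι, ℝ)) =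
      pairing (ContinuousLinearMap.mul ℝ ℝ) (∂_{m} f : 𝓢(EuclideanSpace ℝ ι, ℝ)) g +
        pairing (ContinuousLinearMap.mul ℝ ℝ) f (∂_{m} g : 𝓢(EuclideanSpace ℝ ι, ℝ)) := by
  ext x
  rw [add_apply]
  simp only [lineDerivOp_apply_eq_fderiv, pairing_apply_apply, ContinuousLinearMap.mul_apply']
  have h : (⇑(pairing (ContinuousLinearMap.mul ℝ ℝ) f g) : EuclideanSpace ℝ ι → ℝ) =
      fun y => f y * g y :=
    funext fun y => pairing_apply_apply _ f g y
  rw [h, fderiv_fun_mul f.differentiableAt g.differentiableAt]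
  simp only [add_apply, FunLike.coe_smul, Pi.smul_apply, smul_eq_mul]
  ring

/-- **Leibniz rule for the bundled line derivative, scalar times vector**:
`∂ₘ (f • g) = (∂ₘ f) • g + f • (∂ₘ g)` for `f ∈ 𝓢(ℝ^ι, ℝ)`, `g ∈ 𝓢(ℝ^ι, F)`. [folklore] -/
theorem lineDerivOp_pairing_lsmul (f : 𝓢(EuclideanSpace ℝ ι, ℝ)) (g : 𝓢(EuclideanSpace ℝ ι, F))
    (m : EuclideanSpace ℝ ι) :
    (∂_{m} (pairing (ContinuousLinearMap.lsmul ℝ ℝ) f g) : 𝓢(EuclideanSpace ℝ ι, F)) =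
      pairing (ContinuousLinearMap.lsmul ℝ ℝ) (∂_{m} f : 𝓢(EuclideanSpace ℝ ι, ℝ)) g +
        pairing (ContinuousLinearMap.lsmul ℝ ℝ) f (∂_{m} g : 𝓢(EuclideanSpace ℝ ι, F)) := by
  ext x
  rw [add_apply]
  simp only [lineDerivOp_apply_eq_fderiv, pairing_apply_apply, ContinuousLinearMap.lsmul_apply]
  have h : (⇑(pairing (ContinuousLinearMap.lsmul ℝ ℝ) f g) : EuclideanSpace ℝ ι → F) =
      fun y => f y • g y :=
    funext fun y => pairing_apply_apply _ f g y
  rw [h, fderiv_fun_smul f.differentiableAt g.differentiableAt]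
  simp only [add_apply, FunLike.coe_smul, Pi.smul_apply, ContinuousLinearMap.smulRight_apply]
  abel

/-- Components of a Schwartz field pass through `fderiv`: `D(uᵢ)(x)[m] = (Du(x)[m])ᵢ`
(the tree's `fderiv_apply_coord` of `LocalBiotSavartCalculus` is the `ℝ³` version). [folklore] -/
theorem schwartz_fderiv_apply_coord (U : 𝓢(EuclideanSpace ℝ ι, EuclideanSpace ℝ ι)) (i : ι)
    (x m : EuclideanSpace ℝ ι) :
    fderiv ℝ (fun y => U y i) x m = fderiv ℝ (⇑U) x m i := by
  have h : (fun y => U y i) = ⇑(EuclideanSpace.proj i : EuclideanSpace ℝ ι →L[ℝ] ℝ) ∘ ⇑U := rfl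
  rw [h, ((EuclideanSpace.proj i : EuclideanSpace ℝ ι →L[ℝ] ℝ).hasFDerivAt.comp x
    (U.hasFDerivAt x)).fderiv]
  rfl

variable [DecidableEq ι]

/-- **The divergence in coordinates**: `div u (x) = ∑ⱼ (Du(x)[eⱼ])ⱼ` (the tree's
`divergence_eq_sum_inner_fderiv` for the standard basis of `ℝ^ι`). [folklore] -/
theorem divergence_eq_sum_coord (u : EuclideanSpace ℝ ι → EuclideanSpace ℝ ι)
    (x : EuclideanSpace ℝ ι) :
    VectorCalculus.divergence u x =
      ∑ j, fderiv ℝ u x (EuclideanSpace.single j (1 : ℝ)) j := by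
  rw [divergence_eq_sum_inner_fderiv (EuclideanSpace.basisFun ι ℝ) u x]
  refine Finset.sum_congr rfl fun j _ => ?_
  rw [EuclideanSpace.basisFun_apply, EuclideanSpace.inner_single_left]
  simp

/-- **The convective derivative in coordinates**: `(u·∇)v (x) = ∑ⱼ uⱼ(x) Dv(x)[eⱼ]`.
[folklore] -/
theorem convect_eq_sum_coord (u v : EuclideanSpace ℝ ι → EuclideanSpace ℝ ι)
    (x : EuclideanSpace ℝ ι) :
    convect u v x = ∑ j, u x j • fderiv ℝ v x (EuclideanSpace.single j (1 : ℝ)) := by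
  rw [convect_apply]
  conv_lhs => rw [← (EuclideanSpace.basisFun ι ℝ).sum_repr (u x)]
  rw [map_sum]
  refine Finset.sum_congr rfl fun j _ => ?_
  rw [map_smul, EuclideanSpace.basisFun_repr, EuclideanSpace.basisFun_apply]

end SchwartzCalculus

/-! ### `(U·∇)V + (V·∇)U = div T` for divergence-free Schwartz fields -/

section DivergenceForm

variable [DecidableEq ι] (U V : 𝓢(EuclideanSpace ℝ ι, EuclideanSpace ℝ ι))

/-- **`(U·∇)V + (V·∇)U` is a Schwartz field**: it is the Schwartz map
`W₀ = ∑ⱼ (Uⱼ ∂ⱼV + Vⱼ ∂ⱼU)` (components `Uⱼ = postcompCLM (proj j) U`, products `pairing lsmul`,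
line derivatives `∂ⱼ = ∂_{eⱼ}`). [folklore] -/
theorem coe_convectSchwartz (W₀ : 𝓢(EuclideanSpace ℝ ι, EuclideanSpace ℝ ι))
    (hW₀ : W₀ = ∑ j, (pairing (ContinuousLinearMap.lsmul ℝ ℝ)
        (postcompCLM (EuclideanSpace.proj j : EuclideanSpace ℝ ι →L[ℝ] ℝ) U)
        (∂_{EuclideanSpace.single j (1 : ℝ)} V) +
      pairing (ContinuousLinearMap.lsmul ℝ ℝ)
        (postcompCLM (EuclideanSpace.proj j : EuclideanSpace ℝ ι →L[ℝ] ℝ) V)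
        (∂_{EuclideanSpace.single j (1 : ℝ)} U))) :
    (⇑W₀ : EuclideanSpace ℝ ι → EuclideanSpace ℝ ι) =
      fun x => convect (⇑U) (⇑V) x + convect (⇑V) (⇑U) x := by
  funext x
  rw [hW₀, sum_apply, convect_eq_sum_coord, convect_eq_sum_coord, ← Finset.sum_add_distrib]
  refine Finset.sum_congr rfl fun j _ => ?_
  rw [add_apply, pairing_apply_apply, pairing_apply_apply, postcompCLM_apply, postcompCLM_apply,
    lineDerivOp_apply_eq_fderiv, lineDerivOp_apply_eq_fderiv]
  rfl

/-- **Divergence form** `((U·∇)V + (V·∇)U)ᵢ = ∑ⱼ ∂ⱼ(Uⱼ Vᵢ + Vⱼ Uᵢ)` for divergence-free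
Schwartz fields (`∑ⱼ ∂ⱼ(UⱼVᵢ) = (div U) Vᵢ + ∑ⱼ Uⱼ∂ⱼVᵢ` and `div U = 0`; Tao 2016, (1.8):
`B(u,v) = -½ P div (u ⊗ v + v ⊗ u)` on divergence-free fields). This is the only place where
`div U = div V = 0` enters. [folklore] -/
theorem postcompCLM_proj_convectSchwartz (hU : VectorCalculus.IsDivFree (⇑U))
    (hV : VectorCalculus.IsDivFree (⇑V)) (W₀ : 𝓢(EuclideanSpace ℝ ι, EuclideanSpace ℝ ι))
    (hW₀ : W₀ = ∑ j, (pairing (ContinuousLinearMap.lsmul ℝ ℝ)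
        (postcompCLM (EuclideanSpace.proj j : EuclideanSpace ℝ ι →L[ℝ] ℝ) U)
        (∂_{EuclideanSpace.single j (1 : ℝ)} V) +
      pairing (ContinuousLinearMap.lsmul ℝ ℝ)
        (postcompCLM (EuclideanSpace.proj j : EuclideanSpace ℝ ι →L[ℝ] ℝ) V)
        (∂_{EuclideanSpace.single j (1 : ℝ)} U))) (i : ι) :
    postcompCLM (EuclideanSpace.proj i : EuclideanSpace ℝ ι →L[ℝ] ℝ) W₀ =
      ∑ j, (∂_{EuclideanSpace.single j (1 : ℝ)}
        (pairing (ContinuousLinearMap.mul ℝ ℝ)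
            (postcompCLM (EuclideanSpace.proj j : EuclideanSpace ℝ ι →L[ℝ] ℝ) U)
            (postcompCLM (EuclideanSpace.proj i : EuclideanSpace ℝ ι →L[ℝ] ℝ) V) +
          pairing (ContinuousLinearMap.mul ℝ ℝ)
            (postcompCLM (EuclideanSpace.proj j : EuclideanSpace ℝ ι →L[ℝ] ℝ) V)
            (postcompCLM (EuclideanSpace.proj i : EuclideanSpace ℝ ι →L[ℝ] ℝ) U)) :
        𝓢(EuclideanSpace ℝ ι, ℝ)) := by
  ext x
  -- components as functions
  have h1 : ∀ (W : 𝓢(EuclideanSpace ℝ ι, EuclideanSpace ℝ ι)) (k : ι),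
      (⇑(postcompCLM (EuclideanSpace.proj k : EuclideanSpace ℝ ι →L[ℝ] ℝ) W) :
        EuclideanSpace ℝ ι → ℝ) = fun y => W y k :=
    fun W k => funext fun y => postcompCLM_apply _ W y
  -- unfold the right-hand side with the Leibniz rule
  have hR : ∀ j, (∂_{EuclideanSpace.single j (1 : ℝ)}
      (pairing (ContinuousLinearMap.mul ℝ ℝ)
          (postcompCLM (EuclideanSpace.proj j : EuclideanSpace ℝ ι →L[ℝ] ℝ) U)
          (postcompCLM (EuclideanSpace.proj i : EuclideanSpace ℝ ι →L[ℝ] ℝ) V) +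
        pairing (ContinuousLinearMap.mul ℝ ℝ)
          (postcompCLM (EuclideanSpace.proj j : EuclideanSpace ℝ ι →L[ℝ] ℝ) V)
          (postcompCLM (EuclideanSpace.proj i : EuclideanSpace ℝ ι →L[ℝ] ℝ) U)) :
        𝓢(EuclideanSpace ℝ ι, ℝ)) x =
      (fderiv ℝ (⇑U) x (EuclideanSpace.single j (1 : ℝ)) j * V x i +
        U x j * fderiv ℝ (⇑V) x (EuclideanSpace.single j (1 : ℝ)) i) +
      (fderiv ℝ (⇑V) x (EuclideanSpace.single j (1 : ℝ)) j * U x i +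
        V x j * fderiv ℝ (⇑U) x (EuclideanSpace.single j (1 : ℝ)) i) := by
    intro j
    rw [LineDeriv.lineDerivOp_add, add_apply, lineDerivOp_pairing_mul, lineDerivOp_pairing_mul,
      add_apply, add_apply]
    simp only [pairing_apply_apply, ContinuousLinearMap.mul_apply', postcompCLM_apply,
      lineDerivOp_apply_eq_fderiv]
    simp only [h1, schwartz_fderiv_apply_coord]
    rfl
  have hdivU : ∑ j, fderiv ℝ (⇑U) x (EuclideanSpace.single j (1 : ℝ)) j = 0 := by
    rw [← divergence_eq_sum_coord]; exact hU x
  have hdivV : ∑ j, fderiv ℝ (⇑V) x (EuclideanSpace.single j (1 : ℝ)) j = 0 := by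
    rw [← divergence_eq_sum_coord]; exact hV x
  rw [sum_apply]
  simp only [hR]
  have hL : (postcompCLM (EuclideanSpace.proj i : EuclideanSpace ℝ ι →L[ℝ] ℝ) W₀) x =
      ∑ j, (U x j * fderiv ℝ (⇑V) x (EuclideanSpace.single j (1 : ℝ)) i +
        V x j * fderiv ℝ (⇑U) x (EuclideanSpace.single j (1 : ℝ)) i) := by
    rw [postcompCLM_apply, coe_convectSchwartz U V W₀ hW₀]
    dsimp only
    rw [convect_eq_sum_coord, convect_eq_sum_coord, ← Finset.sum_add_distrib]
    change (∑ j, (U x j • fderiv ℝ (⇑V) x (EuclideanSpace.single j (1 : ℝ)) +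
      V x j • fderiv ℝ (⇑U) x (EuclideanSpace.single j (1 : ℝ)))) i = _
    simp
  rw [hL]
  calc ∑ j, (U x j * fderiv ℝ (⇑V) x (EuclideanSpace.single j (1 : ℝ)) i +
        V x j * fderiv ℝ (⇑U) x (EuclideanSpace.single j (1 : ℝ)) i)
      = ∑ j, (U x j * fderiv ℝ (⇑V) x (EuclideanSpace.single j (1 : ℝ)) i +
          V x j * fderiv ℝ (⇑U) x (EuclideanSpace.single j (1 : ℝ)) i) +
        (∑ j, fderiv ℝ (⇑U) x (EuclideanSpace.single j (1 : ℝ)) j) * V x i +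
        (∑ j, fderiv ℝ (⇑V) x (EuclideanSpace.single j (1 : ℝ)) j) * U x i := by
        rw [hdivU, hdivV]; ring
    _ = _ := by
        rw [Finset.sum_mul, Finset.sum_mul, ← Finset.sum_add_distrib, ← Finset.sum_add_distrib]
        refine Finset.sum_congr rfl fun j _ => ?_
        ring

omit [DecidableEq ι] in
/-- Components of the complexification: `(Wℂ)ᵢ = (Wᵢ : ℂ)` as Schwartz functions (the complex
component is post-composition with the real-linear coordinate map). [folklore] -/
theorem postcompCLM_projC_complexify (W : 𝓢(EuclideanSpace ℝ ι, EuclideanSpace ℝ ι)) (i : ι) :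
    postcompCLM ((EuclideanSpace.proj i : EuclideanSpace ℂ ι →L[ℂ] ℂ).restrictScalars ℝ)
        (postcompCLM FunctionSpaces.EuclideanSpace.complexify.toContinuousLinearMap W) =
      postcompCLM Complex.ofRealCLM
        (postcompCLM (EuclideanSpace.proj i : EuclideanSpace ℝ ι →L[ℝ] ℝ) W) := by
  ext x
  simp only [postcompCLM_apply]
  exact FunctionSpaces.EuclideanSpace.complexify_apply (W x) i

/-- **Divergence form, complexified**: for divergence-free Schwartz `U V` and
`W = ((U·∇)V + (V·∇)U)ℂ`, `Wᵢ = ∑ⱼ ∂ⱼ Tℂ_{ji}` with `T_{ji} = UⱼVᵢ + VⱼUᵢ`. [folklore] -/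
theorem postcompCLM_projC_convectSchwartz (hU : VectorCalculus.IsDivFree (⇑U))
    (hV : VectorCalculus.IsDivFree (⇑V)) (W₀ : 𝓢(EuclideanSpace ℝ ι, EuclideanSpace ℝ ι))
    (hW₀ : W₀ = ∑ j, (pairing (ContinuousLinearMap.lsmul ℝ ℝ)
        (postcompCLM (EuclideanSpace.proj j : EuclideanSpace ℝ ι →L[ℝ] ℝ) U)
        (∂_{EuclideanSpace.single j (1 : ℝ)} V) +
      pairing (ContinuousLinearMap.lsmul ℝ ℝ)
        (postcompCLM (EuclideanSpace.proj j : EuclideanSpace ℝ ι →L[ℝ] ℝ) V)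
        (∂_{EuclideanSpace.single j (1 : ℝ)} U))) (i : ι) :
    postcompCLM ((EuclideanSpace.proj i : EuclideanSpace ℂ ι →L[ℂ] ℂ).restrictScalars ℝ)
        (postcompCLM FunctionSpaces.EuclideanSpace.complexify.toContinuousLinearMap W₀) =
      ∑ j, (∂_{EuclideanSpace.single j (1 : ℝ)} (postcompCLM Complex.ofRealCLM
        (pairing (ContinuousLinearMap.mul ℝ ℝ)
            (postcompCLM (EuclideanSpace.proj j : EuclideanSpace ℝ ι →L[ℝ] ℝ) U)
            (postcompCLM (EuclideanSpace.proj i : EuclideanSpace ℝ ι →L[ℝ] ℝ) V) +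
          pairing (ContinuousLinearMap.mul ℝ ℝ)
            (postcompCLM (EuclideanSpace.proj j : EuclideanSpace ℝ ι →L[ℝ] ℝ) V)
            (postcompCLM (EuclideanSpace.proj i : EuclideanSpace ℝ ι →L[ℝ] ℝ) U))) :
        𝓢(EuclideanSpace ℝ ι, ℂ)) := by
  rw [postcompCLM_projC_complexify, postcompCLM_proj_convectSchwartz U V hU hV W₀ hW₀ i, map_sum]
  refine Finset.sum_congr rfl fun j _ => ?_
  rw [lineDerivOp_postcompCLM]

end DivergenceForm

/-! ### The Fourier side -/

section FourierSide

/-- **Coordinates pass through the Fourier integral**: `(𝓕 f ξ)ᵢ = 𝓕 fᵢ ξ` for integrable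
`f : ℝ^ι → ℂ^ι`. [folklore] -/
theorem fourier_apply_coord {f : EuclideanSpace ℝ ι → EuclideanSpace ℂ ι} (hf : Integrable f)
    (ξ : EuclideanSpace ℝ ι) (i : ι) :
    𝓕 f ξ i = 𝓕 (fun x => f x i) ξ := by
  have h := (Real.fourierIntegral_convergent_iff ξ).2 hf
  rw [Real.fourier_eq, Real.fourier_eq]
  change (EuclideanSpace.proj i : EuclideanSpace ℂ ι →L[ℂ] ℂ) (∫ v, 𝐞 (-⟪v, ξ⟫) • f v) = _
  rw [← ContinuousLinearMap.integral_comp_comm _ h]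
  refine integral_congr_ae (Eventually.of_forall fun v => ?_)
  simp only [Circle.smul_def, map_smul]
  rfl

/-- The complex component as a function: `(postcompCLM projᵢ W) x = (W x)ᵢ`. [folklore] -/
theorem coe_postcompCLM_projC (W : 𝓢(EuclideanSpace ℝ ι, EuclideanSpace ℂ ι)) (i : ι) :
    (⇑(postcompCLM ((EuclideanSpace.proj i : EuclideanSpace ℂ ι →L[ℂ] ℂ).restrictScalars ℝ) W) :
      EuclideanSpace ℝ ι → ℂ) = fun x => W x i :=
  funext fun x => postcompCLM_apply _ W x

variable [DecidableEq ι]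

/-- **`𝓕(div W)(ξ) = 2πi ξ·Ŵ(ξ)`**: for `W ∈ 𝓢(ℝ^ι, ℂ^ι)` and its divergence
`ρ = ∑ᵢ ∂ᵢWᵢ`, `𝓕ρ(ξ) = 2πi ∑ᵢ ξᵢ Ŵᵢ(ξ)`. [folklore] -/
theorem fourier_divSchwartz_apply (W : 𝓢(EuclideanSpace ℝ ι, EuclideanSpace ℂ ι))
    (ρ : 𝓢(EuclideanSpace ℝ ι, ℂ))
    (hρ : ρ = ∑ i, (∂_{EuclideanSpace.single i (1 : ℝ)}
      (postcompCLM ((EuclideanSpace.proj i : EuclideanSpace ℂ ι →L[ℂ] ℂ).restrictScalars ℝ) W) :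
        𝓢(EuclideanSpace ℝ ι, ℂ)))
    (ξ : EuclideanSpace ℝ ι) :
    𝓕 (⇑ρ) ξ = 2 * π * I * ∑ i, (ξ i : ℂ) * 𝓕 (⇑W) ξ i := by
  rw [← fourier_coe, hρ, FourierTransform.fourier_sum, sum_apply, Finset.mul_sum]
  refine Finset.sum_congr rfl fun i _ => ?_
  rw [fourier_coe, fourier_lineDeriv_apply, EuclideanSpace.inner_single_right,
    coe_postcompCLM_projC, ← fourier_apply_coord W.integrable ξ i]
  simp only [one_mul, conj_trivial]
  ring

/-- **The Leray symbol on `Ŵ`**: for `W ∈ 𝓢(ℝ^ι, ℂ^ι)`, its divergence `ρ = ∑ᵢ ∂ᵢWᵢ` and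
every `ξ`, `P̂(ξ)Ŵ(ξ) = Ŵ(ξ) + ∑ₖ M_k(ξ) e_k` with `M_k(ξ) = 𝓕(∂_kρ)(ξ)/((2π)²|ξ|²)`
(`ξ·Ŵ = 𝓕ρ/(2πi)` and `𝓕(∂_kρ) = 2πi ξ_k 𝓕ρ`; at `ξ = 0` both sides are `Ŵ(0)` by the junk
convention `x/0 = 0`). Lemarié-Rieusset 2002, Ch. 11 (`P̂ = I − ξ ⊗ ξ/|ξ|²`). [folklore] -/
theorem leraySymbolC_fourier_eq (W : 𝓢(EuclideanSpace ℝ ι, EuclideanSpace ℂ ι))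
    (ρ : 𝓢(EuclideanSpace ℝ ι, ℂ))
    (hρ : ρ = ∑ i, (∂_{EuclideanSpace.single i (1 : ℝ)}
      (postcompCLM ((EuclideanSpace.proj i : EuclideanSpace ℂ ι →L[ℂ] ℂ).restrictScalars ℝ) W) :
        𝓢(EuclideanSpace ℝ ι, ℂ)))
    (ξ : EuclideanSpace ℝ ι) :
    leraySymbolC ξ (𝓕 (⇑W) ξ) = 𝓕 (⇑W) ξ +
      ∑ k, (𝓕 (⇑(∂_{EuclideanSpace.single k (1 : ℝ)} ρ : 𝓢(EuclideanSpace ℝ ι, ℂ))) ξ /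
        (((2 * π) ^ 2 * ‖ξ‖ ^ 2 : ℝ) : ℂ)) • EuclideanSpace.single k (1 : ℂ) := by
  set q : ℂ := ∑ i, (ξ i : ℂ) * 𝓕 (⇑W) ξ i with hq
  -- the multipliers `M_k`
  have hM : ∀ k, 𝓕 (⇑(∂_{EuclideanSpace.single k (1 : ℝ)} ρ : 𝓢(EuclideanSpace ℝ ι, ℂ))) ξ /
      (((2 * π) ^ 2 * ‖ξ‖ ^ 2 : ℝ) : ℂ) = -(q / ((‖ξ‖ ^ 2 : ℝ) : ℂ) * (ξ k : ℂ)) := by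
    intro k
    rw [fourier_lineDeriv_apply, EuclideanSpace.inner_single_right,
      fourier_divSchwartz_apply W ρ hρ, ← hq]
    simp only [one_mul, conj_trivial]
    rcases eq_or_ne ξ 0 with hξ | hξ
    · simp [hξ]
    have hpos : (0 : ℝ) < ‖ξ‖ ^ 2 := by
      have := norm_pos_iff.2 hξ
      positivity
    have hne : ((‖ξ‖ ^ 2 : ℝ) : ℂ) ≠ 0 := Complex.ofReal_ne_zero.2 hpos.ne'
    have hπ : (π : ℂ) ≠ 0 := Complex.ofReal_ne_zero.2 Real.pi_pos.ne'
    push_cast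
    field_simp
    ring_nf
    rw [Complex.I_sq]
    ring
  simp_rw [hM]
  -- the complexified `ξ` in the standard basis
  have hcplx : FunctionSpaces.EuclideanSpace.complexify ξ =
      ∑ k, (ξ k : ℂ) • EuclideanSpace.single k (1 : ℂ) := by
    conv_lhs => rw [← (EuclideanSpace.basisFun ι ℂ).sum_repr
      (FunctionSpaces.EuclideanSpace.complexify ξ)]
    refine Finset.sum_congr rfl fun k _ => ?_
    rw [EuclideanSpace.basisFun_repr, EuclideanSpace.basisFun_apply,
      FunctionSpaces.EuclideanSpace.complexify_apply]
  unfold leraySymbolC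
  rw [← hq, hcplx, Finset.smul_sum, sub_eq_add_neg, ← Finset.sum_neg_distrib]
  congr 1
  refine Finset.sum_congr rfl fun k _ => ?_
  rw [smul_smul, neg_smul]

/-- **`∂_kρ` is a sum of third-order derivatives** when `W = div T`: if
`Wᵢ = ∑ⱼ ∂ⱼ T_{ji}` for all `i` and `ρ = ∑ᵢ ∂ᵢWᵢ`, then `∂_k ρ = ∑_{(i,j)} ∂_k∂ᵢ∂ⱼ T_{ji}`.
[folklore] -/
theorem lineDerivOp_divSchwartz_eq_sum (W : 𝓢(EuclideanSpace ℝ ι, EuclideanSpace ℂ ι))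
    (T : ι → ι → 𝓢(EuclideanSpace ℝ ι, ℂ))
    (hdiv : ∀ i,
      postcompCLM ((EuclideanSpace.proj i : EuclideanSpace ℂ ι →L[ℂ] ℂ).restrictScalars ℝ) W =
        ∑ j, (∂_{EuclideanSpace.single j (1 : ℝ)} (T j i) : 𝓢(EuclideanSpace ℝ ι, ℂ)))
    (ρ : 𝓢(EuclideanSpace ℝ ι, ℂ))
    (hρ : ρ = ∑ i, (∂_{EuclideanSpace.single i (1 : ℝ)}
      (postcompCLM ((EuclideanSpace.proj i : EuclideanSpace ℂ ι →L[ℂ] ℂ).restrictScalars ℝ) W) :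
        𝓢(EuclideanSpace ℝ ι, ℂ)))
    (k : ι) :
    (∂_{EuclideanSpace.single k (1 : ℝ)} ρ : 𝓢(EuclideanSpace ℝ ι, ℂ)) =
      ∑ m : ι × ι, (∂_{EuclideanSpace.single k (1 : ℝ)} (∂_{EuclideanSpace.single m.1 (1 : ℝ)}
        (∂_{EuclideanSpace.single m.2 (1 : ℝ)} (T m.2 m.1))) : 𝓢(EuclideanSpace ℝ ι, ℂ)) := by
  rw [hρ, Fintype.sum_prod_type]
  rw [← LineDeriv.lineDerivOpCLM_apply (R := ℝ), map_sum]
  refine Finset.sum_congr rfl fun i _ => ?_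
  rw [hdiv i, ← LineDeriv.lineDerivOpCLM_apply (R := ℝ) (E := 𝓢(EuclideanSpace ℝ ι, ℂ))
    (EuclideanSpace.single i (1 : ℝ)), map_sum, map_sum]
  rfl

/-- **The Leray symbol on the Fourier transform of `(U·∇)V + (V·∇)U`, packaged**: for
divergence-free Schwartz fields `U V` on `ℝ^ι` there are a complex Schwartz field `W` with
`W = ((U·∇)V + (V·∇)U)ℂ` and complex Schwartz functions `g_k`, each a finite sum of third-order
line derivatives of Schwartz functions, such that
`P̂(ξ) Ŵ(ξ) = Ŵ(ξ) + ∑ₖ (𝓕g_k(ξ)/((2π)²|ξ|²)) e_k` for every `ξ` (`g_k = ∂_k div W`,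
`W = div (U ⊗ V + V ⊗ U)`). Tao 2016, (1.8) (`B = -½ P div(u ⊗ v + v ⊗ u)`);
Lemarié-Rieusset 2002, Ch. 11. [folklore] -/
theorem exists_leraySymbolC_fourier_repr (U V : 𝓢(EuclideanSpace ℝ ι, EuclideanSpace ℝ ι))
    (hU : VectorCalculus.IsDivFree (⇑U)) (hV : VectorCalculus.IsDivFree (⇑V)) :
    ∃ (W : 𝓢(EuclideanSpace ℝ ι, EuclideanSpace ℂ ι)) (g : ι → 𝓢(EuclideanSpace ℝ ι, ℂ)),
      ((⇑W : EuclideanSpace ℝ ι → EuclideanSpace ℂ ι) =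
        fun x => FunctionSpaces.EuclideanSpace.complexify
          (convect (⇑U) (⇑V) x + convect (⇑V) (⇑U) x)) ∧
      (∀ k, ∃ S : ι × ι → 𝓢(EuclideanSpace ℝ ι, ℂ), g k = ∑ m : ι × ι,
        (∂_{EuclideanSpace.single k (1 : ℝ)} (∂_{EuclideanSpace.single m.1 (1 : ℝ)}
          (∂_{EuclideanSpace.single m.2 (1 : ℝ)} (S m))) : 𝓢(EuclideanSpace ℝ ι, ℂ))) ∧
      ∀ ξ : EuclideanSpace ℝ ι, leraySymbolC ξ (𝓕 (⇑W) ξ) = 𝓕 (⇑W) ξ +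
        ∑ k, (𝓕 (⇑(g k)) ξ / (((2 * π) ^ 2 * ‖ξ‖ ^ 2 : ℝ) : ℂ)) •
          EuclideanSpace.single k (1 : ℂ) := by
  -- `W₀ = (U·∇)V + (V·∇)U`, `W = W₀ℂ`, `T_{ji} = (UⱼVᵢ + VⱼUᵢ)ℂ`, `ρ = div W`
  set W₀ : 𝓢(EuclideanSpace ℝ ι, EuclideanSpace ℝ ι) :=
    ∑ j, (pairing (ContinuousLinearMap.lsmul ℝ ℝ)
        (postcompCLM (EuclideanSpace.proj j : EuclideanSpace ℝ ι →L[ℝ] ℝ) U)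
        (∂_{EuclideanSpace.single j (1 : ℝ)} V) +
      pairing (ContinuousLinearMap.lsmul ℝ ℝ)
        (postcompCLM (EuclideanSpace.proj j : EuclideanSpace ℝ ι →L[ℝ] ℝ) V)
        (∂_{EuclideanSpace.single j (1 : ℝ)} U)) with hW₀
  set W : 𝓢(EuclideanSpace ℝ ι, EuclideanSpace ℂ ι) :=
    postcompCLM FunctionSpaces.EuclideanSpace.complexify.toContinuousLinearMap W₀ with hW
  set T : ι → ι → 𝓢(EuclideanSpace ℝ ι, ℂ) := fun j i => postcompCLM Complex.ofRealCLM
    (pairing (ContinuousLinearMap.mul ℝ ℝ)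
        (postcompCLM (EuclideanSpace.proj j : EuclideanSpace ℝ ι →L[ℝ] ℝ) U)
        (postcompCLM (EuclideanSpace.proj i : EuclideanSpace ℝ ι →L[ℝ] ℝ) V) +
      pairing (ContinuousLinearMap.mul ℝ ℝ)
        (postcompCLM (EuclideanSpace.proj j : EuclideanSpace ℝ ι →L[ℝ] ℝ) V)
        (postcompCLM (EuclideanSpace.proj i : EuclideanSpace ℝ ι →L[ℝ] ℝ) U)) with hT
  set ρ : 𝓢(EuclideanSpace ℝ ι, ℂ) := ∑ i, (∂_{EuclideanSpace.single i (1 : ℝ)}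
    (postcompCLM ((EuclideanSpace.proj i : EuclideanSpace ℂ ι →L[ℂ] ℂ).restrictScalars ℝ) W) :
      𝓢(EuclideanSpace ℝ ι, ℂ)) with hρ
  have hdiv : ∀ i,
      postcompCLM ((EuclideanSpace.proj i : EuclideanSpace ℂ ι →L[ℂ] ℂ).restrictScalars ℝ) W =
        ∑ j, (∂_{EuclideanSpace.single j (1 : ℝ)} (T j i) : 𝓢(EuclideanSpace ℝ ι, ℂ)) :=
    fun i => postcompCLM_projC_convectSchwartz U V hU hV W₀ hW₀ i
  refine ⟨W, fun k => ∂_{EuclideanSpace.single k (1 : ℝ)} ρ, ?_, fun k => ?_, fun ξ => ?_⟩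
  · funext x
    rw [hW, postcompCLM_apply, coe_convectSchwartz U V W₀ hW₀]
    rfl
  · exact ⟨fun m => T m.2 m.1, lineDerivOp_divSchwartz_eq_sum W T hdiv ρ hρ k⟩
  · exact leraySymbolC_fourier_eq W ρ hρ ξ

end FourierSide

end Literature.Analysis.FluidPDE
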